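import Summits.Ventures.CertifiedManyBodySolver.Observables.StiffnessThermalLeaf
import Literature.MathematicalPhysics.QuantumLattice.PeierlsHoppingThermalTwistBound
import Literature.MathematicalPhysics.QuantumLattice.PeierlsHoppingThermalTwistBoundTTPrime
import HarnessLib

/-!
# Ventures/CertifiedManyBodySolver — Observables/StiffnessThermalLeafOrbital.lean

HONEST FRAMING: the ORBITAL-FIELD twin of the thermal KT dictionary (key K1t[A]): a one-sided, utterly non-sharp CEILING `ρₑ(T) ≤ 1`
(tree units, `t = 1`) on the THERMAL uniform flux stiffness of the strictly two-dimensional one-band Hubbard torus in an ARBITRARY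
background lattice `U(1)` gauge field (orbital magnetic field of any flux pattern; `magneticHubbardTorus L A 1 U` of
`MagneticHubbardTorus.lean`), at every temperature, and the Kosterlitz–Thouless-type UPPER bound `T_c ≤ π/4` it gives CONDITIONAL on
the named KT inputs carried in the field; a ceiling never speaks to the presence of order; not a `T_c` estimate, not a
superconductivity verdict; vortices / `H_{c2}` / the physical adequacy of the NK closure in a field are NOT treated.

Cell `hubbard-tc` (MO-S3 ORDER → `T_c` back-end, D-0096; output continuum `T × P × H`, D-0099/D-0100), seat mod-2 (KT back-end),
`prover-hubbard-tc-mod-2-g10-0`; lead RULING R50 (2026-08-27): the orbital analogue of `StiffnessThermalLeafZeeman` (p1, Zeeman field)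
on the Literature theorem `magneticThermalFluxStiffness_le_one` (p540520, the `T > 0` twin of Bloch's bound `magneticFluxStiffness_le_one`,
p525739):

* `IsThermalFluxStiffnessOrbitalSeqAt U n A β ρ` — the identification (K1t[A]): `ρ` is (at most) a thermal flux-stiffness constant of
  the `(N_L, S^z = 0)` sector of the magnetic torus in the gauge-field FAMILY `A = (A_L)_L` (one field per side) at inverse temperature
  `β`, along some `L_j → ∞`, in the sequence-robust sense of `IsThermalFluxStiffnessSeqAt`;
* `IsThermalFluxStiffnessOrbitalSeqAt.le_one` — every identified level is `≤ 1`, at every `β > 0`, every `U`, `n`, every field family;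
* `ThermalKTDictionaryOrbitalAt U n A ρₑ Tc` — K2 stability + K1t[A] identification (every field a HYPOTHESIS, exactly as at zero
  field) and **`ThermalKTDictionaryOrbitalAt.le_pi_div_four : Tc ≤ π/4`** (≈ `0.7854·t`; decimal form `≤ 0.7853982`) — the H-axis
  «orbital» locator of the cell as a kernel row: «k_BT_KT ≤ (π/4)·t per plane at every orbital field, K1t[A] + K1b[A] + K2, no
  `T = 0 → T_KT⁻` transfer» (coverage, not tightness: ×2.47 above the zero-field family row `1/π`).

References: A. Paramekanti, N. Trivedi, M. Randeria, PRB 57 (1998) 11639, eq. (3), §IV [ParamekantiTrivediRanderia1998]; T. Hazra,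
N. Verma, M. Randeria, PRX 9 (2019) 031049, eqs. (2)–(3) [HazraVermaRanderia2019]; D. J. Scalapino, S. R. White, S. Zhang, PRB 47 (1993)
7995, §II [ScalapinoWhiteZhang1993]; D. R. Nelson, J. M. Kosterlitz, PRL 39 (1977) 1201 [NelsonKosterlitz1977]; D. Bohm, Phys. Rev. 75
(1949) 502 [Bohm1949].
-/

noncomputable section

namespace Summit.Ventures.CertifiedManyBodySolver.Observables

open Filter Topology Set Real Matrix
open Literature.MathematicalPhysics.QuantumLattice
open Literature.MathematicalPhysics.QuantumFieldTheory
open Literature.MathematicalPhysics.StatisticalMechanics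
open Literature.MathematicalPhysics.StatisticalMechanics.KosterlitzThouless
open scoped ComplexConjugate ComplexOrder

/-! ## §1 The orbital thermal identification and its unconditional ceiling `≤ 1` -/

/-- **Thermal identification at inverse temperature `β` in the orbital field family `A` (key K1t[A]).** `ρ` is (at most) a thermal
uniform flux-stiffness constant of the `(N_L, S^z = 0)` sector (`N_L = 2⌊nL²/2⌋`) of the magnetic Hubbard torus `magneticHubbardTorus L (A L) 1 U`
in the sequence-robust sense: every level `0 < r < ρ` satisfies `β r θ² ≤ log Z_{L_j}(0) − log Z_{L_j}(θ)` for `|θ| ≤ θ₀` (some `θ₀ > 0`)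
along some sequence of sides `L_j → ∞`, with `log Z_L(θ) = magneticTwistLogZ L (A L) U β θ p_L` (the extra flux `θ` threaded through
the `e₁`-handle on top of `A_L`). A HYPOTHESIS on the profile, consumed by `ThermalKTDictionaryOrbitalAt.thermal`.
[cite: ScalapinoWhiteZhang1993, §II] -/
def IsThermalFluxStiffnessOrbitalSeqAt (U n : ℝ) (A : (L : ℕ) → GaugeConfig 2 L Circle) (β ρ : ℝ) : Prop :=
  ∀ r : ℝ, 0 < r → r < ρ → ∃ θ₀ : ℝ, 0 < θ₀ ∧ ∃ Ls : ℕ → ℕ, Tendsto Ls atTop atTop ∧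
    ∀ (j : ℕ) [NeZero (Ls j)] (θ : ℝ), |θ| ≤ θ₀ →
      β * r * θ ^ 2 ≤
        magneticTwistLogZ (Ls j) (A (Ls j)) U β 0
            (fun s : Finset (Orb (FermionTorus 2 (Ls j))) =>
              s.card = 2 * ⌊n * ((Ls j : ℕ) : ℝ) ^ 2 / 2⌋₊ ∧
                2 * (s.filter fun i => (ofLex i).2 = 0).card = 2 * ⌊n * ((Ls j : ℕ) : ℝ) ^ 2 / 2⌋₊) -
          magneticTwistLogZ (Ls j) (A (Ls j)) U β θ
            (fun s : Finset (Orb (FermionTorus 2 (Ls j))) =>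
              s.card = 2 * ⌊n * ((Ls j : ℕ) : ℝ) ^ 2 / 2⌋₊ ∧
                2 * (s.filter fun i => (ofLex i).2 = 0).card = 2 * ⌊n * ((Ls j : ℕ) : ℝ) ^ 2 / 2⌋₊)

/-- **Every identified orbital thermal flux-stiffness level is at most `1`** (tree units, `t = 1`): at every `β > 0`, for every `U`, `n` and
every gauge-field family — `magneticThermalFluxStiffness_le_one` (the Peierls–Bogoliubov twist bound in the field) at one side `L_j ≥ 2` of
the sequence. [cite: ParamekantiTrivediRanderia1998, eq. (3) and §IV] -/
theorem IsThermalFluxStiffnessOrbitalSeqAt.le_one {U n : ℝ} {A : (L : ℕ) → GaugeConfig 2 L Circle} {β ρ : ℝ}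
    (hρ : IsThermalFluxStiffnessOrbitalSeqAt U n A β ρ) (hβ : 0 < β) : ρ ≤ 1 := by
  -- every level `r ∈ (0, ρ)` is `≤ 1`
  have hr : ∀ r : ℝ, 0 < r → r < ρ → r ≤ 1 := by
    intro r hr0 hrρ
    obtain ⟨θ₀, hθ₀, Ls, hLs, hst⟩ := hρ r hr0 hrρ
    obtain ⟨j, hj⟩ := (hLs.eventually (eventually_ge_atTop 2)).exists
    haveI : NeZero (Ls j) := ⟨by omega⟩
    exact magneticThermalFluxStiffness_le_one hj (A (Ls j)) U _ hβ hθ₀ fun θ hθ => hst j θ hθ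
  refine le_of_forall_lt_imp_le_of_dense fun r hrρ => ?_
  rcases le_or_gt r 0 with hr0 | hr0
  · exact hr0.trans zero_le_one
  · exact hr r hr0 hrρ

/-! ## §2 The orbital thermal KT dictionary (K2 + K1t[A], no K3) and `T_c ≤ π/4` -/

/-- **The monotonicity-free Kosterlitz–Thouless dictionary at `(U, n)` IN THE ORBITAL FIELD FAMILY `A`** for a thermal electron
twist-coefficient profile `ρₑ : ℝ → ℝ` and a candidate transition temperature `Tc`: `pos` (`0 < Tc`), `stable` (K2: `(2/π)T ≤ ρₑ(T)/2`
on `(0, Tc)` — the Nelson–Kosterlitz stability hypothesis, here ASSUMED in the field exactly as at zero field; its physical adequacy in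
a perpendicular field (field-induced free vortices) is NOT claimed), `thermal` (K1t[A]: `ρₑ(T)` identified with a thermal flux stiffness
of the magnetic torus family at `β = 1/T`). Every field is a HYPOTHESIS. [cite: HazraVermaRanderia2019, eqs. (2)–(3)] -/
structure ThermalKTDictionaryOrbitalAt (U n : ℝ) (A : (L : ℕ) → GaugeConfig 2 L Circle) (ρe : ℝ → ℝ) (Tc : ℝ) : Prop where
  /-- `0 < Tc`. -/
  pos : 0 < Tc
  /-- K2: KT stability inequality for the pair stiffness `ρₑ/2` below `Tc`, in the field. -/
  stable : StableBelow (fun T => phaseStiffnessOfTwistCoeff 2 (ρe T)) Tc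
  /-- K1t[A]: at every `T ∈ (0, Tc)`, `ρₑ(T)` is a thermal flux-stiffness constant of the magnetic torus family at `β = 1/T`. -/
  thermal : ∀ ⦃T : ℝ⦄, 0 < T → T < Tc → IsThermalFluxStiffnessOrbitalSeqAt U n A (1 / T) (ρe T)

namespace ThermalKTDictionaryOrbitalAt

variable {U n : ℝ} {A : (L : ℕ) → GaugeConfig 2 L Circle} {ρe : ℝ → ℝ} {Tc : ℝ}

/-- Under the dictionary the profile is positive below `Tc`: stability gives `0 < (2/π)T ≤ ρₑ(T)/2`. [cite: NelsonKosterlitz1977, eq. (1)] -/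
theorem apply_pos (hd : ThermalKTDictionaryOrbitalAt U n A ρe Tc) {T : ℝ} (hT : 0 < T) (hTTc : T < Tc) : 0 < ρe T := by
  have h1 : 2 / π * T ≤ phaseStiffnessOfTwistCoeff 2 (ρe T) := hd.stable hT hTTc
  rw [phaseStiffnessOfTwistCoeff_two] at h1
  have h2 : 0 < 2 / π * T := by positivity
  linarith

/-- Under the dictionary the profile is at most `1` throughout `(0, Tc)` (the orbital thermal twist bound).
[cite: ParamekantiTrivediRanderia1998, eq. (3) and §IV] -/
theorem apply_le_one (hd : ThermalKTDictionaryOrbitalAt U n A ρe Tc) {T : ℝ} (hT : 0 < T) (hTTc : T < Tc) : ρe T ≤ 1 :=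
  (hd.thermal hT hTTc).le_one (one_div_pos.2 hT)

/-- **The H-axis «orbital» row of the cell, K3-free: `Tc ≤ π/4`** (tree units, `t = 1`, `k_B = 1`; `≈ 0.7853982·t`) for every profile
satisfying the orbital thermal KT dictionary at `(U, n)` in ANY gauge-field family `A` (every lattice `U(1)` orbital field, one per side):
the thermal twist bound gives `ρₑ(T) ≤ 1` on `(0, Tc)` at each temperature directly, and NK stability for the pair stiffness `ρₑ/2`
concludes — no certificate, no claim node, no monotonicity, no `T = 0 → T_KT⁻` transfer. Reading: «k_BT_KT ≤ (π/4)·t per plane at every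
orbital field; coverage, not tightness (the zero-field family row is `1/π`)». [cite: HazraVermaRanderia2019, eqs. (2)–(3)]
[cite: NelsonKosterlitz1977, eq. (1)] -/
theorem le_pi_div_four (hd : ThermalKTDictionaryOrbitalAt U n A ρe Tc) : Tc ≤ π / 4 := by
  have h := le_pi_div_four_mul_of_pairTwistCeiling (ρebar := 1) hd.stable hd.pos fun _ hT hTTc => hd.apply_le_one hT hTTc
  simpa using h

/-- **Decimal form:** `Tc ≤ 0.7853982` (`π/4 = 0.78539816…`, via `Real.pi_lt_d20`). [cite: HazraVermaRanderia2019, eqs. (2)–(3)] -/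
theorem le_decimal (hd : ThermalKTDictionaryOrbitalAt U n A ρe Tc) : Tc ≤ (0.7853982 : ℝ) := by
  have h := hd.le_pi_div_four
  have hπ : Real.pi < 3.14159265358979323847 := Real.pi_lt_d20
  have h2 : π / 4 ≤ (0.7853982 : ℝ) := by linarith
  exact h.trans h2

end ThermalKTDictionaryOrbitalAt

/-! ## §3 The `t–t′` band in an orbital field: identification, dictionary and `T_c ≤ (π/4)(1 + 2|t′|)` (appended 2026-08-27, R53) -/

/-- **Thermal identification at inverse temperature `β` for the `t–t′` band in the orbital field family `(A, D)`** (key K1t[A], `t–t′`):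
`ρ` is (at most) a thermal uniform flux-stiffness constant of the `(N_L, S^z = 0)` sector of `magneticHubbardTorusTT' L (A L) (D L) t′ U`
(nearest-neighbour phases `A_L`, diagonal phases `D_L`, one pair per side), sequence-robust: every level `0 < r < ρ` satisfies
`β r θ² ≤ log Z_{L_j}(0) − log Z_{L_j}(θ)` (`log Z = magneticTwistLogZTT'`) for `|θ| ≤ θ₀` along some `L_j → ∞`. A HYPOTHESIS on the
profile. [cite: ScalapinoWhiteZhang1993, §II] -/
def IsThermalFluxStiffnessOrbitalTTSeqAt (tp U n : ℝ) (A : (L : ℕ) → GaugeConfig 2 L Circle)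
    (D : (L : ℕ) → Fin 2 → Literature.MathematicalPhysics.QuantumFieldTheory.Site 2 L → Circle) (β ρ : ℝ) : Prop :=
  ∀ r : ℝ, 0 < r → r < ρ → ∃ θ₀ : ℝ, 0 < θ₀ ∧ ∃ Ls : ℕ → ℕ, Tendsto Ls atTop atTop ∧
    ∀ (j : ℕ) [NeZero (Ls j)] (θ : ℝ), |θ| ≤ θ₀ →
      β * r * θ ^ 2 ≤
        magneticTwistLogZTT' (Ls j) (A (Ls j)) (D (Ls j)) tp U β 0
            (fun s : Finset (Orb (FermionTorus 2 (Ls j))) =>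
              s.card = 2 * ⌊n * ((Ls j : ℕ) : ℝ) ^ 2 / 2⌋₊ ∧
                2 * (s.filter fun i => (ofLex i).2 = 0).card = 2 * ⌊n * ((Ls j : ℕ) : ℝ) ^ 2 / 2⌋₊) -
          magneticTwistLogZTT' (Ls j) (A (Ls j)) (D (Ls j)) tp U β θ
            (fun s : Finset (Orb (FermionTorus 2 (Ls j))) =>
              s.card = 2 * ⌊n * ((Ls j : ℕ) : ℝ) ^ 2 / 2⌋₊ ∧
                2 * (s.filter fun i => (ofLex i).2 = 0).card = 2 * ⌊n * ((Ls j : ℕ) : ℝ) ^ 2 / 2⌋₊)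

/-- **Every identified `t–t′` orbital thermal flux-stiffness level is at most `1 + 2|t′|`** (units of `t`): at every `β > 0`, every
`U`, `n`, every gauge-field family — `magneticThermalFluxStiffnessTT'_le` at one side `L_j ≥ 2`. [cite: ParamekantiTrivediRanderia1998, eq. (3) and §IV] -/
theorem IsThermalFluxStiffnessOrbitalTTSeqAt.le {tp U n : ℝ} {A : (L : ℕ) → GaugeConfig 2 L Circle}
    {D : (L : ℕ) → Fin 2 → Literature.MathematicalPhysics.QuantumFieldTheory.Site 2 L → Circle} {β ρ : ℝ}
    (hρ : IsThermalFluxStiffnessOrbitalTTSeqAt tp U n A D β ρ) (hβ : 0 < β) : ρ ≤ 1 + 2 * |tp| := by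
  have hr : ∀ r : ℝ, 0 < r → r < ρ → r ≤ 1 + 2 * |tp| := by
    intro r hr0 hrρ
    obtain ⟨θ₀, hθ₀, Ls, hLs, hst⟩ := hρ r hr0 hrρ
    obtain ⟨j, hj⟩ := (hLs.eventually (eventually_ge_atTop 2)).exists
    haveI : NeZero (Ls j) := ⟨by omega⟩
    exact magneticThermalFluxStiffnessTT'_le hj (A (Ls j)) (D (Ls j)) tp U _ hβ hθ₀ fun θ hθ => hst j θ hθ
  refine le_of_forall_lt_imp_le_of_dense fun r hrρ => ?_
  rcases le_or_gt r 0 with hr0 | hr0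
  · exact hr0.trans (by positivity)
  · exact hr r hr0 hrρ

/-- **The monotonicity-free KT dictionary for the `t–t′` band in the orbital field family `(A, D)`**: `pos`, `stable` (K2, assumed in
the field as at zero field), `thermal` (K1t[A] identification, `t–t′`). Every field is a HYPOTHESIS. [cite: HazraVermaRanderia2019, eqs. (2)–(3)] -/
structure ThermalKTDictionaryOrbitalTTAt (tp U n : ℝ) (A : (L : ℕ) → GaugeConfig 2 L Circle)
    (D : (L : ℕ) → Fin 2 → Literature.MathematicalPhysics.QuantumFieldTheory.Site 2 L → Circle) (ρe : ℝ → ℝ) (Tc : ℝ) :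
    Prop where
  /-- `0 < Tc`. -/
  pos : 0 < Tc
  /-- K2: KT stability inequality for the pair stiffness `ρₑ/2` below `Tc`, in the field. -/
  stable : StableBelow (fun T => phaseStiffnessOfTwistCoeff 2 (ρe T)) Tc
  /-- K1t[A], `t–t′`: at every `T ∈ (0, Tc)`, `ρₑ(T)` is a thermal flux-stiffness constant of the `t–t′` magnetic torus family at `β = 1/T`. -/
  thermal : ∀ ⦃T : ℝ⦄, 0 < T → T < Tc → IsThermalFluxStiffnessOrbitalTTSeqAt tp U n A D (1 / T) (ρe T)

namespace ThermalKTDictionaryOrbitalTTAt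

variable {tp U n : ℝ} {A : (L : ℕ) → GaugeConfig 2 L Circle}
  {D : (L : ℕ) → Fin 2 → Literature.MathematicalPhysics.QuantumFieldTheory.Site 2 L → Circle} {ρe : ℝ → ℝ} {Tc : ℝ}

/-- Under the `t–t′` orbital dictionary the profile is at most `1 + 2|t′|` throughout `(0, Tc)`. [cite: ParamekantiTrivediRanderia1998, eq. (3) and §IV] -/
theorem apply_le (hd : ThermalKTDictionaryOrbitalTTAt tp U n A D ρe Tc) {T : ℝ} (hT : 0 < T) (hTTc : T < Tc) :
    ρe T ≤ 1 + 2 * |tp| :=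
  (hd.thermal hT hTTc).le (one_div_pos.2 hT)

/-- **The H-axis «orbital» row for the `t–t′` boxes, K3-free: `Tc ≤ (π/4)·(1 + 2|t′|)`** (tree units, `t = 1`) for every profile
satisfying the `t–t′` orbital thermal KT dictionary at `(t′, U, n)` in ANY gauge-field family — the crude field-robust constant until the
three bond families are bounded jointly; at `t′ = 0` it is `ThermalKTDictionaryOrbitalAt.le_pi_div_four`. Reading: «k_BT_KT ≤
(π/4)(1 + 2|t′/t|)·t per plane at every orbital field; coverage, not tightness». [cite: HazraVermaRanderia2019, eqs. (2)–(3)]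
[cite: NelsonKosterlitz1977, eq. (1)] -/
theorem le_pi_div_four_mul (hd : ThermalKTDictionaryOrbitalTTAt tp U n A D ρe Tc) : Tc ≤ π / 4 * (1 + 2 * |tp|) :=
  le_pi_div_four_mul_of_pairTwistCeiling (ρebar := 1 + 2 * |tp|) hd.stable hd.pos fun _ hT hTTc => hd.apply_le hT hTTc

/-- **Decimal form:** `Tc ≤ 0.7853982·(1 + 2|t′|)`. [cite: HazraVermaRanderia2019, eqs. (2)–(3)] -/
theorem le_decimal_mul (hd : ThermalKTDictionaryOrbitalTTAt tp U n A D ρe Tc) : Tc ≤ (0.7853982 : ℝ) * (1 + 2 * |tp|) := by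
  have h := hd.le_pi_div_four_mul
  have hπ : Real.pi < 3.14159265358979323847 := Real.pi_lt_d20
  have htp : 0 ≤ 1 + 2 * |tp| := by positivity
  have h2 : π / 4 * (1 + 2 * |tp|) ≤ (0.7853982 : ℝ) * (1 + 2 * |tp|) :=
    mul_le_mul_of_nonneg_right (by linarith) htp
  exact h.trans h2

end ThermalKTDictionaryOrbitalTTAt

end Summit.Ventures.CertifiedManyBodySolver.Observables

end
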